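import Summits.BirchSwinnertonDyer.Rank1Residual.GaloisImage.ThreeAdicFrobeniusWitness
import HarnessLib

/-!
# Per-curve kernel instances of the `3`-adic tower on the EXOTIC-candidate cells through the
# one-prime Frobenius door (β-witness) — file 19/19
# (cell `b2b-bsdres`, team n1011, seat p10 gen 6 — row T-b11-TINST; 6 cells: 499392jp1, 499392jt1, 499392kv1, 499392lc1, 499392lu1, 499392ma1)

HONEST FRAMING (cell `b2b-bsdres`, run/shared/lean/b2b/bsd-rank1-residual/, verbatim in every
file): the goal of the cell is to DELETE the COMBINATION-SHAPED residual classes of the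
Birch–Swinnerton-Dyer formula for ALL analytic-rank `≤ 1` elliptic curves over `ℚ` — "full BSD
formula for every rank `≤ 1` curve in class `C`" assembled STRICTLY from published theorems — so
that the rank-`≤ 1` remainder becomes exactly the CONSTRUCTION-SHAPED classes, which are TYPED
(missing-input `Prop`s), NOT attempted. This is not "finishing BSD". Team n1011 (N10 / N11):
research route; no claim beyond the stated classes; labels UNCHANGED; nothing is booked. Theorems
only (no definition, no named fact); PER CURVE instances (a certificate shape), not class theorems.

## What this file proves

For each of 6 cells `L` of the EXOTIC core `v₃(j − 1728) = 3` (p02 `m3/sample.json` = p14 `tb1`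
v1.4 extract, 749 rank-`0` `X4 @ 3` cells) whose census tower bit is `cert` ("a mod-`9` certificate
is needed", p14 `T-b1-ENGINE1.md`), which is NOT one of the 20 Elkies curves, and which carries NO
kernel tower theorem `towerSurj*_v<L>` elsewhere in the tree (258 of the 321 non-Elkies candidates;
the other 63 = p03's 60 family-(A) cube-root instances `WildThreeCubeRootInstances1–3` /
`…Certificate` + lit-kato's `ThreeAdicFrobeniusWitnessRecords1–4`) — ONE theorem

  `towerSurj3_frob_v<L> (hI : integralModelInt W = ⟨a₁,…,a₆⟩) (hsurj : ρ̄_{E,3} onto) (n) :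
     ρ̄_{E,3ⁿ} onto`

(+ its corollary `imageContainsSL2_three_frob_v<L>` = Kato's (12.5.2) at `3`) for ANY globally
minimal elliptic `W/ℚ` with Cremona's integral model, by ONE application of the EXISTING door
`forall_hasSurjectiveModNGaloisRep_three_pow_of_intModel_of_frobenius`
(`GaloisImage/ThreeAdicFrobeniusWitness.lean`, over lit-kato's
`WeierstrassCurve.forall_hasSurjectiveModNGaloisRep_three_pow_of_frobenius`,
`Literature/…/Kato2004/ThreeAdicFrobeniusCertificate.lean`): ONE good prime `ℓ ≡ 2, 5 (mod 9)` with
`a_ℓ = ℓ + 1 − #(E₀ mod ℓ)(𝔽_ℓ) ≡ 3, 6 (mod 9)` (an arithmetic Frobenius `φ` at `ℓ` then has `ρ(φ)²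
= 1 + 3M₀` on `T₃E` with `M₀ mod 3` neither scalar nor traceless ⟹ `im ρ̄_9 ⊇ ker(GL₂(ℤ/9) →
GL₂(𝔽₃))` ⟹ the tower by Serre's inductive step), the point count `#(E₀ mod ℓ)(𝔽_ℓ)` DECIDED IN THE
KERNEL (`decide +kernel` on the Euler-criterion sum `card_sol_eq_sum_euler`, exactly as lit-kato's
records) and the two residues by `decide`. The census bit `surj(3)` stays a hypothesis (T-b11-INST
currency; the cell's mod-`3` image certificates `surj3_v<L>` discharge it per record where wanted).
The 20 Elkies curves are untouched (no β-witness exists for them: `ρ(φ)²` is scalar mod `9` on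
Elkies' group — lit-kato's census, 0/20 up to `ℓ ≤ 3000` here) and stay the EXOTIC family of record;
a cell certified here is, given `surj(3)`, by definition NOT exotic — it leaves the CANDIDATE list.

Table of record: `HOME/b2b-bsdres-n1011-p10/g6/TINST-table.tsv` (258 rows: label, a-invariants,
`v₃N`, Kodaira, `v₃j`, the least β-witness prime `ℓ`, `n_ℓ = #(E₀ mod ℓ)(𝔽_ℓ)`, `a_ℓ`, residues;
generator `tinst_table.py` + `tinst_lean.py`, static python, second source for `n_ℓ` = the kernel).
WHAT CHANGES (numbers, not adjectives): these cells' tower moves from EVIDENCE (p02's PARI one-prime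
order-`9` certificates / engine bits) to a KERNEL instance modulo `surj(3)`; with all 19 files
the kernel's EXOTIC CANDIDATE list at `v₃(j − 1728) = 3` is the 20 Elkies curves; nothing booked;
no mark; X4 stays CONSTRUCTION-SHAPED.

References: [SerreAbelianLadic1968] Ch. IV §3.4 Lemma 3 (IV-23); [Elkies2006] Introduction, §1;
[Kato2004Asterisque] (12.5.2) p. 222; [CremonaAlgorithms1997] Table 1 (the models);
[SilvermanAEC2009] C.21 Remark 21.3 (trace and norm of Frobenius).
-/

noncomputable section

open scoped Classical

open WeierstrassCurve Literature.NumberTheory.EllipticCurves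
  Summit.BirchSwinnertonDyer.BirchSwinnertonDyer.Rank1Residual.IntModel

namespace Summit.BirchSwinnertonDyer.Rank1Residual.GaloisImage
/-- `499392jp1` (`N = 499392`, `v₃(N) = 3`, Kodaira `II` at `3`, `v₃(j) = 3`; census tower bit `cert`): `#Ẽ(𝔽_47) = 42` for Cremona's model `[0, 0, 0, -204, 1360]` (`47 ∤ Δ`; `47 ≡ 2 (mod 9)`, `a_47 = 6 ≡ 6 (mod 9)`). [folklore] -/
theorem card_frob_v499392jp1_47 :
    Nat.card (((⟨0, 0, 0, -204, 1360⟩ : WeierstrassCurve ℤ).map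
      (Int.castRingHom (ZMod 47))).toAffine.Point) = 42 := by
  rw [@WeierstrassCurve.natCard_point_eq_one_add_card (ZMod 47) (@ZMod.instField 47 ⟨by norm_num⟩) _ _ _
    (by decide +kernel), @card_sol_eq_sum_euler (ZMod 47) (@ZMod.instField 47 ⟨by norm_num⟩) _ _
    (by rw [ZMod.ringChar_zmod_n]; decide), ZMod.card]
  decide +kernel

/-- **The `3`-adic tower for Cremona 499392jp1**, given `ρ̄_{E,3}` onto: β-witness `ℓ = 47` (`47 ≡ 2 (mod 9)`, `#Ẽ(𝔽_47) = 42`, `a_47 = 6 ≡ 6 (mod 9)`). [cite: SerreAbelianLadic1968, Ch. IV §3.4, Lemma 3 (IV-23)] [cite: CremonaAlgorithms1997, Table 1] -/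
theorem towerSurj3_frob_v499392jp1 {W : WeierstrassCurve ℚ} [W.IsElliptic] [W.IsGloballyMinimal]
    (hI : integralModelInt W = ⟨0, 0, 0, -204, 1360⟩) (hsurj : W.HasSurjectiveModNGaloisRep 3) (n : ℕ) :
    W.HasSurjectiveModNGaloisRep (3 ^ n : ℕ) :=
  @forall_hasSurjectiveModNGaloisRep_three_pow_of_intModel_of_frobenius W _ _ _ hI hsurj
    47 ⟨by norm_num⟩ (by decide +kernel) _ card_frob_v499392jp1_47 (by decide) (by decide) n

/-- **Kato's (12.5.2) at `3` for Cremona 499392jp1** (CANDIDATE cell), given `ρ̄_{E,3}` onto: the image of `Gal(ℚ̄/ℚ(ζ_{3^∞}))` in `Aut(T₃E)` contains `SL₂(ℤ₃)`. [cite: Kato2004Asterisque, (12.5.2) in Thm. 12.5 (4) (p. 222)] -/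
theorem imageContainsSL2_three_frob_v499392jp1 {W : WeierstrassCurve ℚ} [W.IsElliptic]
    [W.IsGloballyMinimal] (hI : integralModelInt W = ⟨0, 0, 0, -204, 1360⟩)
    (hsurj : W.HasSurjectiveModNGaloisRep 3) : Kato2004.ImageContainsSL2 W 3 :=
  haveI : Fact (Nat.Prime 3) := ⟨Nat.prime_three⟩
  Kato2004.imageContainsSL2_of_forall_hasSurjectiveModNGaloisRep W 3 (towerSurj3_frob_v499392jp1 hI hsurj)

/-- `499392jt1` (`N = 499392`, `v₃(N) = 3`, Kodaira `IV*` at `3`, `v₃(j) = 3`; census tower bit `cert`): `#Ẽ(𝔽_47) = 42` for Cremona's model `[0, 0, 0, -530604, 180405360]` (`47 ∤ Δ`; `47 ≡ 2 (mod 9)`, `a_47 = 6 ≡ 6 (mod 9)`). [folklore] -/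
theorem card_frob_v499392jt1_47 :
    Nat.card (((⟨0, 0, 0, -530604, 180405360⟩ : WeierstrassCurve ℤ).map
      (Int.castRingHom (ZMod 47))).toAffine.Point) = 42 := by
  rw [@WeierstrassCurve.natCard_point_eq_one_add_card (ZMod 47) (@ZMod.instField 47 ⟨by norm_num⟩) _ _ _
    (by decide +kernel), @card_sol_eq_sum_euler (ZMod 47) (@ZMod.instField 47 ⟨by norm_num⟩) _ _
    (by rw [ZMod.ringChar_zmod_n]; decide), ZMod.card]
  decide +kernel

/-- **The `3`-adic tower for Cremona 499392jt1**, given `ρ̄_{E,3}` onto: β-witness `ℓ = 47` (`47 ≡ 2 (mod 9)`, `#Ẽ(𝔽_47) = 42`, `a_47 = 6 ≡ 6 (mod 9)`). [cite: SerreAbelianLadic1968, Ch. IV §3.4, Lemma 3 (IV-23)] [cite: CremonaAlgorithms1997, Table 1] -/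
theorem towerSurj3_frob_v499392jt1 {W : WeierstrassCurve ℚ} [W.IsElliptic] [W.IsGloballyMinimal]
    (hI : integralModelInt W = ⟨0, 0, 0, -530604, 180405360⟩) (hsurj : W.HasSurjectiveModNGaloisRep 3) (n : ℕ) :
    W.HasSurjectiveModNGaloisRep (3 ^ n : ℕ) :=
  @forall_hasSurjectiveModNGaloisRep_three_pow_of_intModel_of_frobenius W _ _ _ hI hsurj
    47 ⟨by norm_num⟩ (by decide +kernel) _ card_frob_v499392jt1_47 (by decide) (by decide) n

/-- **Kato's (12.5.2) at `3` for Cremona 499392jt1** (CANDIDATE cell), given `ρ̄_{E,3}` onto: the image of `Gal(ℚ̄/ℚ(ζ_{3^∞}))` in `Aut(T₃E)` contains `SL₂(ℤ₃)`. [cite: Kato2004Asterisque, (12.5.2) in Thm. 12.5 (4) (p. 222)] -/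
theorem imageContainsSL2_three_frob_v499392jt1 {W : WeierstrassCurve ℚ} [W.IsElliptic]
    [W.IsGloballyMinimal] (hI : integralModelInt W = ⟨0, 0, 0, -530604, 180405360⟩)
    (hsurj : W.HasSurjectiveModNGaloisRep 3) : Kato2004.ImageContainsSL2 W 3 :=
  haveI : Fact (Nat.Prime 3) := ⟨Nat.prime_three⟩
  Kato2004.imageContainsSL2_of_forall_hasSurjectiveModNGaloisRep W 3 (towerSurj3_frob_v499392jt1 hI hsurj)

/-- `499392kv1` (`N = 499392`, `v₃(N) = 3`, Kodaira `IV*` at `3`, `v₃(j) = 3`; census tower bit `cert`): `#Ẽ(𝔽_5) = 3` for Cremona's model `[0, 0, 0, -1836, -124848]` (`5 ∤ Δ`; `5 ≡ 5 (mod 9)`, `a_5 = 3 ≡ 3 (mod 9)`). [folklore] -/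
theorem card_frob_v499392kv1_5 :
    Nat.card (((⟨0, 0, 0, -1836, -124848⟩ : WeierstrassCurve ℤ).map
      (Int.castRingHom (ZMod 5))).toAffine.Point) = 3 := by
  rw [@WeierstrassCurve.natCard_point_eq_one_add_card (ZMod 5) (@ZMod.instField 5 ⟨by norm_num⟩) _ _ _
    (by decide +kernel), @card_sol_eq_sum_euler (ZMod 5) (@ZMod.instField 5 ⟨by norm_num⟩) _ _
    (by rw [ZMod.ringChar_zmod_n]; decide), ZMod.card]
  decide +kernel

/-- **The `3`-adic tower for Cremona 499392kv1**, given `ρ̄_{E,3}` onto: β-witness `ℓ = 5` (`5 ≡ 5 (mod 9)`, `#Ẽ(𝔽_5) = 3`, `a_5 = 3 ≡ 3 (mod 9)`). [cite: SerreAbelianLadic1968, Ch. IV §3.4, Lemma 3 (IV-23)] [cite: CremonaAlgorithms1997, Table 1] -/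
theorem towerSurj3_frob_v499392kv1 {W : WeierstrassCurve ℚ} [W.IsElliptic] [W.IsGloballyMinimal]
    (hI : integralModelInt W = ⟨0, 0, 0, -1836, -124848⟩) (hsurj : W.HasSurjectiveModNGaloisRep 3) (n : ℕ) :
    W.HasSurjectiveModNGaloisRep (3 ^ n : ℕ) :=
  @forall_hasSurjectiveModNGaloisRep_three_pow_of_intModel_of_frobenius W _ _ _ hI hsurj
    5 ⟨by norm_num⟩ (by decide +kernel) _ card_frob_v499392kv1_5 (by decide) (by decide) n

/-- **Kato's (12.5.2) at `3` for Cremona 499392kv1** (CANDIDATE cell), given `ρ̄_{E,3}` onto: the image of `Gal(ℚ̄/ℚ(ζ_{3^∞}))` in `Aut(T₃E)` contains `SL₂(ℤ₃)`. [cite: Kato2004Asterisque, (12.5.2) in Thm. 12.5 (4) (p. 222)] -/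
theorem imageContainsSL2_three_frob_v499392kv1 {W : WeierstrassCurve ℚ} [W.IsElliptic]
    [W.IsGloballyMinimal] (hI : integralModelInt W = ⟨0, 0, 0, -1836, -124848⟩)
    (hsurj : W.HasSurjectiveModNGaloisRep 3) : Kato2004.ImageContainsSL2 W 3 :=
  haveI : Fact (Nat.Prime 3) := ⟨Nat.prime_three⟩
  Kato2004.imageContainsSL2_of_forall_hasSurjectiveModNGaloisRep W 3 (towerSurj3_frob_v499392kv1 hI hsurj)

/-- `499392lc1` (`N = 499392`, `v₃(N) = 3`, Kodaira `II` at `3`, `v₃(j) = 3`; census tower bit `cert`): `#Ẽ(𝔽_5) = 3` for Cremona's model `[0, 0, 0, -58956, -22717712]` (`5 ∤ Δ`; `5 ≡ 5 (mod 9)`, `a_5 = 3 ≡ 3 (mod 9)`). [folklore] -/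
theorem card_frob_v499392lc1_5 :
    Nat.card (((⟨0, 0, 0, -58956, -22717712⟩ : WeierstrassCurve ℤ).map
      (Int.castRingHom (ZMod 5))).toAffine.Point) = 3 := by
  rw [@WeierstrassCurve.natCard_point_eq_one_add_card (ZMod 5) (@ZMod.instField 5 ⟨by norm_num⟩) _ _ _
    (by decide +kernel), @card_sol_eq_sum_euler (ZMod 5) (@ZMod.instField 5 ⟨by norm_num⟩) _ _
    (by rw [ZMod.ringChar_zmod_n]; decide), ZMod.card]
  decide +kernel

/-- **The `3`-adic tower for Cremona 499392lc1**, given `ρ̄_{E,3}` onto: β-witness `ℓ = 5` (`5 ≡ 5 (mod 9)`, `#Ẽ(𝔽_5) = 3`, `a_5 = 3 ≡ 3 (mod 9)`). [cite: SerreAbelianLadic1968, Ch. IV §3.4, Lemma 3 (IV-23)] [cite: CremonaAlgorithms1997, Table 1] -/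
theorem towerSurj3_frob_v499392lc1 {W : WeierstrassCurve ℚ} [W.IsElliptic] [W.IsGloballyMinimal]
    (hI : integralModelInt W = ⟨0, 0, 0, -58956, -22717712⟩) (hsurj : W.HasSurjectiveModNGaloisRep 3) (n : ℕ) :
    W.HasSurjectiveModNGaloisRep (3 ^ n : ℕ) :=
  @forall_hasSurjectiveModNGaloisRep_three_pow_of_intModel_of_frobenius W _ _ _ hI hsurj
    5 ⟨by norm_num⟩ (by decide +kernel) _ card_frob_v499392lc1_5 (by decide) (by decide) n

/-- **Kato's (12.5.2) at `3` for Cremona 499392lc1** (CANDIDATE cell), given `ρ̄_{E,3}` onto: the image of `Gal(ℚ̄/ℚ(ζ_{3^∞}))` in `Aut(T₃E)` contains `SL₂(ℤ₃)`. [cite: Kato2004Asterisque, (12.5.2) in Thm. 12.5 (4) (p. 222)] -/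
theorem imageContainsSL2_three_frob_v499392lc1 {W : WeierstrassCurve ℚ} [W.IsElliptic]
    [W.IsGloballyMinimal] (hI : integralModelInt W = ⟨0, 0, 0, -58956, -22717712⟩)
    (hsurj : W.HasSurjectiveModNGaloisRep 3) : Kato2004.ImageContainsSL2 W 3 :=
  haveI : Fact (Nat.Prime 3) := ⟨Nat.prime_three⟩
  Kato2004.imageContainsSL2_of_forall_hasSurjectiveModNGaloisRep W 3 (towerSurj3_frob_v499392lc1 hI hsurj)

/-- `499392lu1` (`N = 499392`, `v₃(N) = 3`, Kodaira `II` at `3`, `v₃(j) = 3`; census tower bit `cert`): `#Ẽ(𝔽_5) = 3` for Cremona's model `[0, 0, 0, -58956, 22717712]` (`5 ∤ Δ`; `5 ≡ 5 (mod 9)`, `a_5 = 3 ≡ 3 (mod 9)`). [folklore] -/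
theorem card_frob_v499392lu1_5 :
    Nat.card (((⟨0, 0, 0, -58956, 22717712⟩ : WeierstrassCurve ℤ).map
      (Int.castRingHom (ZMod 5))).toAffine.Point) = 3 := by
  rw [@WeierstrassCurve.natCard_point_eq_one_add_card (ZMod 5) (@ZMod.instField 5 ⟨by norm_num⟩) _ _ _
    (by decide +kernel), @card_sol_eq_sum_euler (ZMod 5) (@ZMod.instField 5 ⟨by norm_num⟩) _ _
    (by rw [ZMod.ringChar_zmod_n]; decide), ZMod.card]
  decide +kernel

/-- **The `3`-adic tower for Cremona 499392lu1**, given `ρ̄_{E,3}` onto: β-witness `ℓ = 5` (`5 ≡ 5 (mod 9)`, `#Ẽ(𝔽_5) = 3`, `a_5 = 3 ≡ 3 (mod 9)`). [cite: SerreAbelianLadic1968, Ch. IV §3.4, Lemma 3 (IV-23)] [cite: CremonaAlgorithms1997, Table 1] -/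
theorem towerSurj3_frob_v499392lu1 {W : WeierstrassCurve ℚ} [W.IsElliptic] [W.IsGloballyMinimal]
    (hI : integralModelInt W = ⟨0, 0, 0, -58956, 22717712⟩) (hsurj : W.HasSurjectiveModNGaloisRep 3) (n : ℕ) :
    W.HasSurjectiveModNGaloisRep (3 ^ n : ℕ) :=
  @forall_hasSurjectiveModNGaloisRep_three_pow_of_intModel_of_frobenius W _ _ _ hI hsurj
    5 ⟨by norm_num⟩ (by decide +kernel) _ card_frob_v499392lu1_5 (by decide) (by decide) n

/-- **Kato's (12.5.2) at `3` for Cremona 499392lu1** (CANDIDATE cell), given `ρ̄_{E,3}` onto: the image of `Gal(ℚ̄/ℚ(ζ_{3^∞}))` in `Aut(T₃E)` contains `SL₂(ℤ₃)`. [cite: Kato2004Asterisque, (12.5.2) in Thm. 12.5 (4) (p. 222)] -/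
theorem imageContainsSL2_three_frob_v499392lu1 {W : WeierstrassCurve ℚ} [W.IsElliptic]
    [W.IsGloballyMinimal] (hI : integralModelInt W = ⟨0, 0, 0, -58956, 22717712⟩)
    (hsurj : W.HasSurjectiveModNGaloisRep 3) : Kato2004.ImageContainsSL2 W 3 :=
  haveI : Fact (Nat.Prime 3) := ⟨Nat.prime_three⟩
  Kato2004.imageContainsSL2_of_forall_hasSurjectiveModNGaloisRep W 3 (towerSurj3_frob_v499392lu1 hI hsurj)

/-- `499392ma1` (`N = 499392`, `v₃(N) = 3`, Kodaira `IV*` at `3`, `v₃(j) = 3`; census tower bit `cert`): `#Ẽ(𝔽_5) = 3` for Cremona's model `[0, 0, 0, -1836, 124848]` (`5 ∤ Δ`; `5 ≡ 5 (mod 9)`, `a_5 = 3 ≡ 3 (mod 9)`). [folklore] -/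
theorem card_frob_v499392ma1_5 :
    Nat.card (((⟨0, 0, 0, -1836, 124848⟩ : WeierstrassCurve ℤ).map
      (Int.castRingHom (ZMod 5))).toAffine.Point) = 3 := by
  rw [@WeierstrassCurve.natCard_point_eq_one_add_card (ZMod 5) (@ZMod.instField 5 ⟨by norm_num⟩) _ _ _
    (by decide +kernel), @card_sol_eq_sum_euler (ZMod 5) (@ZMod.instField 5 ⟨by norm_num⟩) _ _
    (by rw [ZMod.ringChar_zmod_n]; decide), ZMod.card]
  decide +kernel

/-- **The `3`-adic tower for Cremona 499392ma1**, given `ρ̄_{E,3}` onto: β-witness `ℓ = 5` (`5 ≡ 5 (mod 9)`, `#Ẽ(𝔽_5) = 3`, `a_5 = 3 ≡ 3 (mod 9)`). [cite: SerreAbelianLadic1968, Ch. IV §3.4, Lemma 3 (IV-23)] [cite: CremonaAlgorithms1997, Table 1] -/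
theorem towerSurj3_frob_v499392ma1 {W : WeierstrassCurve ℚ} [W.IsElliptic] [W.IsGloballyMinimal]
    (hI : integralModelInt W = ⟨0, 0, 0, -1836, 124848⟩) (hsurj : W.HasSurjectiveModNGaloisRep 3) (n : ℕ) :
    W.HasSurjectiveModNGaloisRep (3 ^ n : ℕ) :=
  @forall_hasSurjectiveModNGaloisRep_three_pow_of_intModel_of_frobenius W _ _ _ hI hsurj
    5 ⟨by norm_num⟩ (by decide +kernel) _ card_frob_v499392ma1_5 (by decide) (by decide) n

/-- **Kato's (12.5.2) at `3` for Cremona 499392ma1** (CANDIDATE cell), given `ρ̄_{E,3}` onto: the image of `Gal(ℚ̄/ℚ(ζ_{3^∞}))` in `Aut(T₃E)` contains `SL₂(ℤ₃)`. [cite: Kato2004Asterisque, (12.5.2) in Thm. 12.5 (4) (p. 222)] -/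
theorem imageContainsSL2_three_frob_v499392ma1 {W : WeierstrassCurve ℚ} [W.IsElliptic]
    [W.IsGloballyMinimal] (hI : integralModelInt W = ⟨0, 0, 0, -1836, 124848⟩)
    (hsurj : W.HasSurjectiveModNGaloisRep 3) : Kato2004.ImageContainsSL2 W 3 :=
  haveI : Fact (Nat.Prime 3) := ⟨Nat.prime_three⟩
  Kato2004.imageContainsSL2_of_forall_hasSurjectiveModNGaloisRep W 3 (towerSurj3_frob_v499392ma1 hI hsurj)


end Summit.BirchSwinnertonDyer.Rank1Residual.GaloisImage

end
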